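import Summits.BirchSwinnertonDyer.Rank1Residual.P2.CornerFTwoModelInertJ
import Literature.NumberTheory.EllipticCurves.QuadraticTwistLocalDataAtTwoHoldsProofs
import Literature.NumberTheory.EllipticCurves.NoEverywhereGoodReductionRat
import Literature.NumberTheory.EllipticCurves.CongruentNumberCurveSupersingular
import Literature.NumberTheory.EllipticCurves.LFunctionPrimeCoeff
import HarnessLib

/-!
# Leaf CornerF @ `p = 2` — THE MODEL ATLAS, file 7 (cell `bsd-print-cf2`, D-0131 (2) print tier,
# typer ty2): the atlas families AT THE PRIME `2` — which models are GOOD at `2` (local lemmas)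

HONEST FRAMING (cell `bsd-print-cf2`, HOME `run/shared/lean/pub/bsd-print-cf2/`, verbatim in every
file): the partition leaf is `CornerF W 2` — `W/ℚ` globally minimal elliptic WITH CM and
`ord_{s=1} L(E,s) = 1`, at the prime `2` (rung leaf `WAllCornerFTwo`; OPEN AS A CLASS). Nothing
class-wide is closed here. Route `PrintCf2` rev 5 (planner g2, 2026-08-27T15:39Z) registered, on the inert
children stmt-BirchSwinnertonDyer-20671 `InertJZeroOfFacts` (`j = 0`) and stmt-BirchSwinnertonDyer-20672
`InertOddHeegnerJOfFacts` (five odd-Heegner `j`), birth stubs cut by REDUCTION TYPE AT `2` (`Good W 2` /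
`¬ Good W 2` = PARTITION cells INERT-GOOD / INERT-BAD). This file supplies the local arithmetic that
turns that cut into congruences on the atlas parameters (files 8–9, `CornerFTwoModelInertCells`,
`CornerFTwoModelCubeSums`, state the cells):

* `good_two_iff_of_smul_quadraticTwist` — **the quadratic-twist dichotomy at `2`**: for `E/ℚ` good at
  `2`, `4 ∤ d`, and ANY `ℚ`-model `W` of `E^{(d)}`: `Good W 2 ↔ d ≡ 1 (mod 4)`. Input:
  Barrios–Roy–Sahajpal–Tallana–Tobin–Wiersema 2025 Thm. 5.1, rows `R = I₀` — a PROVED tree theorem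
  (`BarriosEtAl2025_quadraticTwist_two_of_goodReduction_holds`, Tate's algorithm over `ℤ₂`): the twist
  has Kodaira symbol `I₀` (`d ≡ 1`), `I₄*`/`II*` (`d ≡ 3`), `I₈*`/`II` (`d ≡ 2 (mod 4)`); plus the
  `ℚ₂`-isomorphism invariance of the symbol (`kodairaSymbol_smul_holds`) and Step 1
  (`kodairaSymbol_eq_I_zero_iff`);
* `good_two_cm11/19/43/67/163` — the five odd-Heegner bases are good at `2` (odd `Δ = −p³`);
* **the sextic family `y² = x³ + B` at `2`** (`B ∈ ℤ∖{0}`, reduced so that `2⁶ ∤ B`: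
  `exists_smul_sextic_int_not_dvd_of_j_eq_zero`): `good_two_iff_of_smul_sextic` — a globally minimal
  model is good at `2` iff `B ≡ 16 (mod 64)`, i.e. iff the curve is `≅ y² + y = x³ + a`, `a ∈ ℤ`
  (`smul_cubicA₃_eq_sextic`; Cremona's shape of `27a1`, `27a3`, `243a1`). The bad class `B = 16B₁`,
  `B₁ ≡ 3 (mod 4)` is the twist by `−1` of the good class (`quadraticTwist_mk_a₆`); the classes
  `v₂(B) ≢ 4 (mod 6)` are excluded by `Δ = −2⁴·27·B² = u¹²Δ_min` (`padicValInt_emod_six_of_good_of_smul_sextic`).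

Fact-free: NO arithmetic fact, NO definition, NO named fact (D-0026); `beyond-print: NO` (interface).

References: [BarriosEtAl2025] Thm. 5.1, §5 tables rows `R = I₀` (arXiv:2501.03209 pp. 15–16);
[SilvermanAEC2009] VII.1 Rem. 1.1, VII.5 Prop. 5.1(a), X.5 Prop. 5.4 (iii); [SilvermanATAEC1994]
IV.9.4 Step 1, App. A §3; `P2/CornerFTwoModelAtlas.lean` (file 1), `P2/CornerFTwoModelInertJ.lean` (file 6).
-/

noncomputable section

open scoped Classical

open WeierstrassCurve Literature.NumberTheory.EllipticCurves
  Literature.NumberTheory.EllipticCurves.Rank1Residual IsDedekindDomain NumberField Rat.HeightOneSpectrum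

set_option autoImplicit false

namespace Summit.BirchSwinnertonDyer.Rank1Residual.P2.CornerFTwo

namespace Atlas

/-! ## §0 Local lemmas at `2` -/

/-- An integral `ℤ`-model with `p ∤ Δ` has good reduction at `p` (any model, minimal or not):
Silverman VII.5 Prop. 5.1(a) via the tree's place-indexed `hasGoodReductionAt_map_of_not_dvd` and
the bridge `hasGoodReductionAtPrime_iff_hasGoodReductionAt_ringOfIntegers`.
[cite: SilvermanAEC2009, VII.5 Prop. 5.1(a) (PDF p. 174) and VII.1 Remark 1.1] -/
theorem good_of_intModel_of_not_dvd (E : WeierstrassCurve ℤ) (p : ℕ) [Fact p.Prime]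
    (h : ¬ (p : ℤ) ∣ E.Δ) : (E.map (Int.castRingHom ℚ)).HasGoodReductionAtPrime p := by
  obtain ⟨v, rfl⟩ : ∃ v : HeightOneSpectrum (𝓞 ℚ), (primesEquiv v : ℕ) = p :=
    ⟨primesEquiv.symm ⟨p, Fact.out⟩, by rw [Equiv.apply_symm_apply]⟩
  exact (hasGoodReductionAtPrime_iff_hasGoodReductionAt_ringOfIntegers v _).2
    (hasGoodReductionAt_map_of_not_dvd E v h)

/-- **The quadratic-twist dichotomy at `2`** (Barrios–Roy–Sahajpal–Tallana–Tobin–Wiersema 2025,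
Thm. 5.1, rows `R = I₀`, a PROVED tree theorem `BarriosEtAl2025_quadraticTwist_two_of_goodReduction_holds`):
for `E/ℚ` with good reduction at `2`, an integer `d` with `4 ∤ d`, and ANY `ℚ`-model `W` of the twist
`E^{(d)}` (`C • E^{(d)} = W`): `W` has good reduction at `2` iff `d ≡ 1 (mod 4)` — over `ℚ₂` the twist
has Kodaira symbol `I₀` if `d ≡ 1`, `I₄*`/`II*` if `d ≡ 3`, `I₈*`/`II` if `d ≡ 2 (mod 4)`, the symbol is
a `ℚ₂`-isomorphism invariant (`kodairaSymbol_smul_holds`) and equals `I₀` iff the local minimal model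
has good reduction (`kodairaSymbol_eq_I_zero_iff`, Tate's algorithm Step 1).
[cite: BarriosEtAl2025, Thm. 5.1 with the rows R = I₀ of the §5 tables (arXiv:2501.03209 pp. 15–16)]
[cite: SilvermanATAEC1994, IV.9.4 (Tate's algorithm, Step 1)] -/
theorem good_two_iff_of_smul_quadraticTwist (E W : WeierstrassCurve ℚ) [E.IsElliptic] [W.IsElliptic]
    (hE : E.HasGoodReductionAtPrime 2) {d : ℤ} (hd4 : ¬ (4 : ℤ) ∣ d) {C : VariableChange ℚ}
    (hC : C • E.quadraticTwist (d : ℚ) = W) : Good W 2 ↔ d % 4 = 1 := by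
  haveI := TwistGoodTwo.perfectField_residueField_padicInt
  have hB := BarriosEtAl2025_quadraticTwist_two_of_goodReduction_holds (E.baseChange ℚ_[2]) hE d
  have hC' : C⁻¹ • W = E.quadraticTwist (d : ℚ) := by rw [← hC, inv_smul_smul]
  have hbc : (C⁻¹.map (algebraMap ℚ ℚ_[2])) • W.baseChange ℚ_[2] =
      (E.baseChange ℚ_[2]).quadraticTwist (d : ℚ_[2]) := by
    simp only [WeierstrassCurve.baseChange]
    rw [map_variableChange, hC', map_quadraticTwist, map_intCast]
  have hK : (W.baseChange ℚ_[2]).kodairaSymbol ℤ_[2] =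
      ((E.baseChange ℚ_[2]).quadraticTwist (d : ℚ_[2])).kodairaSymbol ℤ_[2] := by
    rw [← hbc, kodairaSymbol_smul_holds ℤ_[2] (W.baseChange ℚ_[2])]
  have hiff : Good W 2 ↔ (W.baseChange ℚ_[2]).kodairaSymbol ℤ_[2] = .I 0 :=
    (kodairaSymbol_eq_I_zero_iff (R := ℤ_[2]) (W.baseChange ℚ_[2])).symm
  rw [hiff, hK]
  constructor
  · intro h0
    rcases (show d % 4 = 1 ∨ d % 4 = 2 ∨ d % 4 = 3 by omega) with h1 | h2 | h3
    · exact h1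
    · obtain ⟨h, -⟩ := hB.2.2 (by unfold Int.ModEq; omega)
      rw [h0] at h
      rcases h with h | h <;> exact absurd h (by decide)
    · obtain ⟨h, -⟩ := hB.2.1 (by unfold Int.ModEq; omega)
      rw [h0] at h
      rcases h with h | h <;> exact absurd h (by decide)
  · intro h1
    exact (hB.1 (by unfold Int.ModEq; omega)).1

/-- Same dichotomy for a square-free twisting parameter (`d ∈ ℤ∖{0}` square-free, so `4 ∤ d`):
`Good W 2 ↔ d ≡ 1 (mod 4)`; the negation reads `¬ Good W 2 ↔ d % 4 ≠ 1` (`↔ d ≡ 2, 3 (mod 4)`).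
[cite: BarriosEtAl2025, Thm. 5.1 with the rows R = I₀ of the §5 tables (arXiv:2501.03209 pp. 15–16)] -/
theorem good_two_iff_of_smul_quadraticTwist_of_squarefree (E W : WeierstrassCurve ℚ) [E.IsElliptic]
    [W.IsElliptic] (hE : E.HasGoodReductionAtPrime 2) {d : ℤ} (hd : Squarefree d)
    {C : VariableChange ℚ} (hC : C • E.quadraticTwist (d : ℚ) = W) : Good W 2 ↔ d % 4 = 1 := by
  -- a square-free `d` is not divisible by `4 = 2·2`
  have h4 : ¬ (4 : ℤ) ∣ d := fun h =>
    by rcases Int.isUnit_iff.mp (hd 2 (by norm_num; exact h)) with h1 | h1 <;> norm_num at h1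
  exact good_two_iff_of_smul_quadraticTwist E W hE h4 hC

/-! ### The five odd-Heegner bases are good at `2` (odd conductors `11², 19², 43², 67², 163²`) -/

/-- `cm11 = 121b1 = ⟨0, −1, 1, −7, 10⟩` has good reduction at `2`: its integer model has odd
discriminant `Δ = −11³`. [cite: SilvermanATAEC1994, App. A §3 (second table, row D = -11)] -/
theorem good_two_cm11 : cm11.HasGoodReductionAtPrime 2 := by
  have e : (⟨0, -1, 1, -7, 10⟩ : WeierstrassCurve ℤ).map (Int.castRingHom ℚ) = cm11 := by
    ext <;> simp [WeierstrassCurve.map]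
  rw [← e]
  refine good_of_intModel_of_not_dvd _ 2 ?_
  norm_num [WeierstrassCurve.Δ, WeierstrassCurve.b₂, WeierstrassCurve.b₄, WeierstrassCurve.b₆,
    WeierstrassCurve.b₈]

/-- `cm19 = 361a1 = ⟨0, 0, 1, −38, 90⟩` has good reduction at `2` (`Δ = −19³` odd).
[cite: SilvermanATAEC1994, App. A §3 (second table, row D = -19)] -/
theorem good_two_cm19 : cm19.HasGoodReductionAtPrime 2 := by
  have e : (⟨0, 0, 1, -38, 90⟩ : WeierstrassCurve ℤ).map (Int.castRingHom ℚ) = cm19 := by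
    ext <;> simp [WeierstrassCurve.map]
  rw [← e]
  refine good_of_intModel_of_not_dvd _ 2 ?_
  norm_num [WeierstrassCurve.Δ, WeierstrassCurve.b₂, WeierstrassCurve.b₄, WeierstrassCurve.b₆,
    WeierstrassCurve.b₈]

/-- `cm43 = 1849a1 = ⟨0, 0, 1, −860, 9707⟩` has good reduction at `2` (`Δ = −43³` odd).
[cite: SilvermanATAEC1994, App. A §3 (second table, row D = -43)] -/
theorem good_two_cm43 : cm43.HasGoodReductionAtPrime 2 := by
  have e : (⟨0, 0, 1, -860, 9707⟩ : WeierstrassCurve ℤ).map (Int.castRingHom ℚ) = cm43 := by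
    ext <;> simp [WeierstrassCurve.map]
  rw [← e]
  refine good_of_intModel_of_not_dvd _ 2 ?_
  norm_num [WeierstrassCurve.Δ, WeierstrassCurve.b₂, WeierstrassCurve.b₄, WeierstrassCurve.b₆,
    WeierstrassCurve.b₈]

/-- `cm67 = 4489a1 = ⟨0, 0, 1, −7370, 243528⟩` has good reduction at `2` (`Δ = −67³` odd).
[cite: SilvermanATAEC1994, App. A §3 (second table, row D = -67)] -/
theorem good_two_cm67 : cm67.HasGoodReductionAtPrime 2 := by
  have e : (⟨0, 0, 1, -7370, 243528⟩ : WeierstrassCurve ℤ).map (Int.castRingHom ℚ) = cm67 := by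
    ext <;> simp [WeierstrassCurve.map]
  rw [← e]
  refine good_of_intModel_of_not_dvd _ 2 ?_
  norm_num [WeierstrassCurve.Δ, WeierstrassCurve.b₂, WeierstrassCurve.b₄, WeierstrassCurve.b₆,
    WeierstrassCurve.b₈]

/-- `cm163 = 26569a1 = ⟨0, 0, 1, −2174420, 1234136692⟩` has good reduction at `2` (`Δ = −163³` odd).
[cite: SilvermanATAEC1994, App. A §3 (second table, row D = -163)] -/
theorem good_two_cm163 : cm163.HasGoodReductionAtPrime 2 := by
  have e : (⟨0, 0, 1, -2174420, 1234136692⟩ : WeierstrassCurve ℤ).map (Int.castRingHom ℚ) =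
      cm163 := by
    ext <;> simp [WeierstrassCurve.map]
  rw [← e]
  refine good_of_intModel_of_not_dvd _ 2 ?_
  norm_num [WeierstrassCurve.Δ, WeierstrassCurve.b₂, WeierstrassCurve.b₄, WeierstrassCurve.b₆,
    WeierstrassCurve.b₈]

/-! ### The sextic family `y² = x³ + B` at `2` -/

/-- The scaling `u = 1/2`: `y² = x³ + B ≅ y² = x³ + 64B` over `ℚ` (`a₆ ↦ u⁻⁶a₆`), so at `j = 0`
only the class of `B` up to factors `2⁶ = 64` matters at the prime `2`.
[cite: SilvermanAEC2009, X.5 Prop. 5.4 (iii)] -/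
theorem smul_sextic_sixtyFour (B : ℚ) :
    (⟨Units.mk0 (2⁻¹ : ℚ) (by norm_num), 0, 0, 0⟩ : VariableChange ℚ) •
        (⟨0, 0, 0, 0, B⟩ : WeierstrassCurve ℚ) = ⟨0, 0, 0, 0, 64 * B⟩ := by
  ext
  · simp [WeierstrassCurve.variableChange_a₁]
  · simp [WeierstrassCurve.variableChange_a₂]
  · simp [WeierstrassCurve.variableChange_a₃]
  · simp [WeierstrassCurve.variableChange_a₄]
  · simp only [WeierstrassCurve.variableChange_a₆, Units.val_inv_eq_inv_val, Units.val_mk0]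
    norm_num

/-- **Reduced sextic normal form at `j = 0`**: every elliptic `W/ℚ` with `j(W) = 0` is a `ℚ`-model of
`y² = x³ + B` with `B ∈ ℤ∖{0}` and `64 ∤ B` (divide out `2⁶` by the scaling `u = 2`,
`smul_sextic_sixtyFour`). [cite: SilvermanAEC2009, X.5 Prop. 5.4 (iii)] -/
theorem exists_smul_sextic_int_not_dvd_of_j_eq_zero {W : WeierstrassCurve ℚ} [W.IsElliptic]
    (hj : W.j = 0) :
    ∃ B : ℤ, B ≠ 0 ∧ ¬ (64 : ℤ) ∣ B ∧
      ∃ C : VariableChange ℚ, C • (⟨0, 0, 0, 0, (B : ℚ)⟩ : WeierstrassCurve ℚ) = W := by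
  obtain ⟨B, hB, hW⟩ := exists_smul_sextic_int_of_j_eq_zero hj
  -- strong induction on `|B|`
  suffices H : ∀ n : ℕ, ∀ B : ℤ, B.natAbs = n → B ≠ 0 →
      (∃ C : VariableChange ℚ, C • (⟨0, 0, 0, 0, (B : ℚ)⟩ : WeierstrassCurve ℚ) = W) →
      ∃ B' : ℤ, B' ≠ 0 ∧ ¬ (64 : ℤ) ∣ B' ∧
        ∃ C : VariableChange ℚ, C • (⟨0, 0, 0, 0, (B' : ℚ)⟩ : WeierstrassCurve ℚ) = W from
    H B.natAbs B rfl hB hW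
  intro n
  induction n using Nat.strong_induction_on with
  | _ n ih =>
    intro B hn hB0 hBW
    by_cases h64 : (64 : ℤ) ∣ B
    · obtain ⟨B', rfl⟩ := h64
      have hB' : B' ≠ 0 := by rintro rfl; exact hB0 (by simp)
      have hlt : B'.natAbs < n := by
        rw [← hn, Int.natAbs_mul]
        have : 0 < B'.natAbs := Int.natAbs_pos.mpr hB'
        simp only [Int.reduceAbs]
        omega
      obtain ⟨C, hC⟩ := hBW
      refine ih _ hlt B' rfl hB' ⟨C * ⟨Units.mk0 (2⁻¹ : ℚ) (by norm_num), 0, 0, 0⟩, ?_⟩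
      rw [mul_smul, smul_sextic_sixtyFour, ← hC]
      congr 1
      push_cast
      ring_nf
    · exact ⟨B, hB0, h64, hBW⟩

/-- The completing-the-square isomorphism `y² + y = x³ + a ≅ y² = x³ + 16(4a + 1)` over `ℚ`
(`u = 1/2`, `t = −1/2`). [cite: SilvermanAEC2009, III.1 (substitution y ↦ (y − a₃)/2, PDF p. 42)] -/
theorem smul_cubicA₃_eq_sextic (a : ℚ) :
    (⟨Units.mk0 (2⁻¹ : ℚ) (by norm_num), 0, 0, -2⁻¹⟩ : VariableChange ℚ) •
        (⟨0, 0, 1, 0, a⟩ : WeierstrassCurve ℚ) = ⟨0, 0, 0, 0, 16 * (4 * a + 1)⟩ := by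
  ext
  · simp [WeierstrassCurve.variableChange_a₁]
  · simp [WeierstrassCurve.variableChange_a₂]
  · simp only [WeierstrassCurve.variableChange_a₃, Units.val_inv_eq_inv_val, Units.val_mk0]
    norm_num
  · simp only [WeierstrassCurve.variableChange_a₄, Units.val_inv_eq_inv_val, Units.val_mk0]
    norm_num
  · simp only [WeierstrassCurve.variableChange_a₆, Units.val_inv_eq_inv_val, Units.val_mk0]
    norm_num
    ring

/-- `y² + y = x³ + a`, `a ∈ ℤ`, has good reduction at `2`: an integral model with odd discriminant
`Δ = −27(4a + 1)²` (the shape of Cremona's `27a1 = ⟨0,0,1,0,−7⟩`, `27a3 = ⟨0,0,1,0,0⟩`,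
`243a1 = ⟨0,0,1,0,−1⟩`). [cite: SilvermanAEC2009, VII.5 Prop. 5.1(a)] -/
theorem good_two_cubicA₃ (a : ℤ) :
    Good (⟨0, 0, 1, 0, (a : ℚ)⟩ : WeierstrassCurve ℚ) 2 := by
  have e : (⟨0, 0, 1, 0, a⟩ : WeierstrassCurve ℤ).map (Int.castRingHom ℚ) = ⟨0, 0, 1, 0, (a : ℚ)⟩ := by
    ext <;> simp [WeierstrassCurve.map]
  rw [Good, ← e]
  refine good_of_intModel_of_not_dvd _ 2 ?_
  have hΔ : (⟨0, 0, 1, 0, a⟩ : WeierstrassCurve ℤ).Δ = -27 * (1 + 8 * a + 16 * (a * a)) := by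
    simp [WeierstrassCurve.Δ, WeierstrassCurve.b₂, WeierstrassCurve.b₄, WeierstrassCurve.b₆,
      WeierstrassCurve.b₈]
    ring
  rw [hΔ]
  generalize a * a = m
  omega

/-- **Good class**: `y² = x³ + 16(4a + 1)` (`a ∈ ℤ`) — i.e. `B ≡ 16 (mod 64)` — has good reduction at
`2`, being `ℚ`-isomorphic to `y² + y = x³ + a`. [cite: SilvermanAEC2009, VII.5 Prop. 5.1(a)] -/
theorem good_two_sextic_of_emod_sixtyFour {B : ℤ} (hB : B % 64 = 16) :
    Good (⟨0, 0, 0, 0, (B : ℚ)⟩ : WeierstrassCurve ℚ) 2 := by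
  obtain ⟨a, rfl⟩ : ∃ a : ℤ, B = 16 * (4 * a + 1) := ⟨(B - 16) / 64, by omega⟩
  have e := smul_cubicA₃_eq_sextic (a : ℚ)
  have e' : (⟨0, 0, 0, 0, 16 * (4 * (a : ℚ) + 1)⟩ : WeierstrassCurve ℚ) =
      ⟨0, 0, 0, 0, ((16 * (4 * a + 1) : ℤ) : ℚ)⟩ := by push_cast; rfl
  rw [← e', ← e, Good, hasGoodReductionAtPrime_iff_of_variableChange]
  exact good_two_cubicA₃ a

/-- **Bad class, odd part `≡ 3 (mod 4)`**: `y² = x³ + 16(4a + 3)` does NOT have good reduction at `2`: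
it is the quadratic twist by `d = −1` (`−1 ≡ 3 (mod 4)`, `2` ramified in `ℚ(i)`) of the good curve
`y² = x³ − 16(4a + 3) = x³ + 16(4(−a − 1) + 1)` (`quadraticTwist_mk_a₆`), so Barrios et al. Thm. 5.1
makes it of Kodaira type `I₄*` or `II*` at `2`.
[cite: BarriosEtAl2025, Thm. 5.1 with the rows R = I₀ of the §5 tables (arXiv:2501.03209 pp. 15–16)] -/
theorem not_good_two_sextic_of_emod_sixtyFour {B : ℤ} (hB : B % 64 = 48) :
    ¬ Good (⟨0, 0, 0, 0, (B : ℚ)⟩ : WeierstrassCurve ℚ) 2 := by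
  have hE : Good (⟨0, 0, 0, 0, ((-B : ℤ) : ℚ)⟩ : WeierstrassCurve ℚ) 2 :=
    good_two_sextic_of_emod_sixtyFour (by omega)
  have hB0 : (B : ℚ) ≠ 0 := by exact_mod_cast (show B ≠ 0 by omega)
  have hB0' : ((-B : ℤ) : ℚ) ≠ 0 := by exact_mod_cast (show -B ≠ 0 by omega)
  haveI := isElliptic_of_j_zero_model hB0
  haveI := isElliptic_of_j_zero_model hB0'
  have htw : (1 : VariableChange ℚ) •
      (⟨0, 0, 0, 0, ((-B : ℤ) : ℚ)⟩ : WeierstrassCurve ℚ).quadraticTwist ((-1 : ℤ) : ℚ) =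
        ⟨0, 0, 0, 0, (B : ℚ)⟩ := by
    rw [one_smul, quadraticTwist_mk_a₆]
    push_cast
    ring_nf
  intro hgood
  have h := (good_two_iff_of_smul_quadraticTwist _ _ hE (d := -1) (by decide) htw).mp hgood
  omega

/-- **`2`-adic valuation test.** If a globally minimal model `W` of `y² = x³ + B` (`B ∈ ℤ∖{0}`) has
good reduction at `2`, then `v₂(B) ≡ 4 (mod 6)`: `Δ(y² = x³ + B) = −2⁴·27·B² = u¹² Δ_min(W)` with
`u ∈ ℚˣ` and `2 ∤ Δ_min(W)`. [cite: SilvermanAEC2009, VII.1 Remark 1.1 and VII.5 Prop. 5.1(a)] -/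
theorem padicValInt_emod_six_of_good_of_smul_sextic {W : WeierstrassCurve ℚ} [W.IsElliptic]
    [W.IsGloballyMinimal] {B : ℤ} (hB : B ≠ 0) {C : VariableChange ℚ}
    (hC : C • (⟨0, 0, 0, 0, (B : ℚ)⟩ : WeierstrassCurve ℚ) = W) (hgood : Good W 2) :
    padicValInt 2 B % 6 = 4 := by
  -- `Δ_min(W) · 1 = u⁻¹² · (−432 B²)` in `ℚ`
  have hΔV : (⟨0, 0, 0, 0, (B : ℚ)⟩ : WeierstrassCurve ℚ).Δ = -432 * (B : ℚ) ^ 2 := by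
    simp [WeierstrassCurve.Δ, WeierstrassCurve.b₂, WeierstrassCurve.b₄, WeierstrassCurve.b₆,
      WeierstrassCurve.b₈]
    ring
  have hΔ : (W.minimalDiscriminantInt : ℚ) = ((C.u⁻¹ : ℚˣ) : ℚ) ^ 12 * (-432 * (B : ℚ) ^ 2) := by
    rw [cast_minimalDiscriminantInt, ← hC, variableChange_Δ, hΔV]
  -- `2 ∤ Δ_min`
  have hndvd : ¬ ((2 : ℕ) : ℤ) ∣ W.minimalDiscriminantInt := fun h =>
    not_hasGoodReductionAtPrime_of_dvd_minimalDiscriminantInt W 2 h hgood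
  have h0 : padicValRat 2 (W.minimalDiscriminantInt : ℚ) = 0 := by
    rw [padicValRat.of_int, padicValInt.eq_zero_of_not_dvd hndvd]; simp
  have hu : ((C.u⁻¹ : ℚˣ) : ℚ) ≠ 0 := (C.u⁻¹).ne_zero
  have hBQ : (B : ℚ) ≠ 0 := by exact_mod_cast hB
  have h432 : padicValRat 2 (-432 : ℚ) = 4 := by
    have h2 : padicValRat 2 (2 : ℚ) = 1 := by
      have := padicValRat.self (p := 2) (by norm_num)
      simpa using this
    have h27 : padicValRat 2 (27 : ℚ) = 0 := by
      have : padicValRat 2 ((27 : ℕ) : ℚ) = 0 := by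
        rw [padicValRat.of_nat]
        simp [padicValNat.eq_zero_of_not_dvd (show ¬ 2 ∣ 27 by norm_num)]
      simpa using this
    rw [show (-432 : ℚ) = -((2 : ℚ) ^ 4 * 27) by norm_num, padicValRat.neg,
      padicValRat.mul (by norm_num) (by norm_num), padicValRat.pow, h2, h27]
    norm_num
  have hv := congrArg (padicValRat 2) hΔ
  rw [h0, padicValRat.mul (pow_ne_zero _ hu) (mul_ne_zero (by norm_num) (pow_ne_zero _ hBQ)),
    padicValRat.pow, padicValRat.mul (by norm_num) (pow_ne_zero _ hBQ), h432,
    padicValRat.pow, padicValRat.of_int] at hv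
  -- `0 = 12 k + 4 + 2 v₂(B)` with `k = v₂(u⁻¹) ∈ ℤ`
  set k : ℤ := padicValRat 2 ((C.u⁻¹ : ℚˣ) : ℚ) with hk
  push_cast at hv
  omega

/-- **THE SEXTIC FAMILY AT `2`.** For `B ∈ ℤ∖{0}` with `64 ∤ B` and any globally minimal `ℚ`-model
`W` of `y² = x³ + B`: `W` has good reduction at `2` iff `B ≡ 16 (mod 64)` (iff `y² = x³ + B ≅
y² + y = x³ + a`, `B = 16(4a + 1)`). Proof: `⇐` `good_two_sextic_of_emod_sixtyFour`; `⇒` the valuation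
test forces `v₂(B) = 4`, `B = 16B₁` with `B₁` odd, and `B₁ ≡ 3 (mod 4)` is the twist-by-`−1` class,
additive at `2` (`not_good_two_sextic_of_emod_sixtyFour`). (The folklore criterion "`y² = x³ + D`,
`D` sixth-power free, is good at `2` iff `D ≡ 16 (mod 64)`".)
[cite: SilvermanAEC2009, VII.1 Remark 1.1 and VII.5 Prop. 5.1(a)]
[cite: BarriosEtAl2025, Thm. 5.1 with the rows R = I₀ of the §5 tables (arXiv:2501.03209 pp. 15–16)] -/
theorem good_two_iff_of_smul_sextic {W : WeierstrassCurve ℚ} [W.IsElliptic] [W.IsGloballyMinimal]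
    {B : ℤ} (hB : B ≠ 0) (h64 : ¬ (64 : ℤ) ∣ B) {C : VariableChange ℚ}
    (hC : C • (⟨0, 0, 0, 0, (B : ℚ)⟩ : WeierstrassCurve ℚ) = W) : Good W 2 ↔ B % 64 = 16 := by
  constructor
  · intro hgood
    have h6 := padicValInt_emod_six_of_good_of_smul_sextic hB hC hgood
    -- `v₂(B) ≤ 5` since `2⁶ ∤ B`, hence `v₂(B) = 4`
    have hlt : padicValInt 2 B < 6 := by
      by_contra hle
      exact h64 (by
        have := (padicValInt_dvd_iff (p := 2) 6 B).mpr (Or.inr (by omega))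
        simpa using this)
    have hv4 : padicValInt 2 B = 4 := by omega
    have h16 : (16 : ℤ) ∣ B := by
      have := (padicValInt_dvd_iff (p := 2) 4 B).mpr (Or.inr (by omega))
      simpa using this
    have h32 : ¬ (32 : ℤ) ∣ B := by
      intro h
      have := (padicValInt_dvd_iff (p := 2) 5 B).mp (by simpa using h)
      omega
    -- `B = 16 B₁`, `B₁` odd: `B % 64 ∈ {16, 48}`
    rcases (show B % 64 = 16 ∨ B % 64 = 48 by omega) with h | h
    · exact h
    · exact absurd (by rwa [← hC, Good, hasGoodReductionAtPrime_iff_of_variableChange] at hgood)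
        (not_good_two_sextic_of_emod_sixtyFour h)
  · intro h
    rw [← hC, Good, hasGoodReductionAtPrime_iff_of_variableChange]
    exact good_two_sextic_of_emod_sixtyFour h

end Atlas

end Summit.BirchSwinnertonDyer.Rank1Residual.P2.CornerFTwo

end
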